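import Literature.MathematicalPhysics.QuantumFieldTheory.Balaban1983to89.B9Eq316AveragingSquaresZdPer
import Literature.MathematicalPhysics.QuantumFieldTheory.Balaban1983to89.B9Eq333ProjectionCovarianceZd
import Literature.MathematicalPhysics.QuantumFieldTheory.Balaban1983to89.B9Eq332FieldAvgCovariance
import Literature.MathematicalPhysics.QuantumFieldTheory.Balaban1983to89.B8Ineq159GaugeCovariance
import Literature.MathematicalPhysics.QuantumFieldTheory.Balaban1983to89.B9Eq340HolderZd

/-!
# `Balaban1983to89.B9Thm311FlatHolonomyKernelZdPer` — [Balaban1985BackgroundPropagators] THEOREM 3.11 AT EVERY FLAT PERIODIC BACKGROUND OF THE TORUS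
# `T_P` READ ON `ℤᵈ`, ARBITRARY HOLONOMY: for the genuine four-letter record `opsAllZdPer` on the Hermitian periodic carrier `E_𝔤^per(P) = domSubHPer P` at
# the all-torus class of [Balaban1985RegularSpaces] p. 77, `Δ_a(U₀)` is POSITIVE DEFINITE — hence `RegularAtHPer` — at every `P`-periodic unitary `U₀`
# whose plaquette variables are all `1`, including the constant commuting backgrounds with non-trivial holonomy around the cycles that are NOT
# gauge-equivalent to `1`; route: a flat configuration is a PURE GAUGE on the contractible lattice `ℤᵈ` (any group), the Poincaré lemma on `ℤᵈ` is its
# additive instance, and the kernel conditions transport through the gauge covariance (3.32)–(3.34) of every letter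

statement-level skeleton of published theorems with citation tags; proofs where landed; nothing here is a claim about the
Yang–Mills mass gap

`[Balaban1985BackgroundPropagators]` ("B9", CMP **99** (1985) 389–434) Thm 3.11 p. 416 *«the operators Δ′_a, G′, (Q′G′²Q′*)⁻¹, Δ_a, G are positive definite»*
(stated for all backgrounds of the class (3.35), which on the torus contains flat backgrounds with holonomy), (3.21)–(3.23) p. 394, (3.26)–(3.27) p. 395,
(3.28)–(3.34) pp. 395–396 (gauge covariance of every letter: *«the equalities (3.32) hold again»*), (3.115) p. 418 «Q_j d = D_j Q′_j».  `[Balaban1985Averaging]`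
("B7", CMP **98**) (8)–(11) pp. 18–19 (gauge transformations, parallel transport), pp. 24–25 (*«v₀(x) := V(Γ_{y,x}) … V₀(Γ_{y,x}) = 1 … V₀(x, x+e₁) = 1»* — the
axial gauge), (44) p. 24, (122)∕(125) p. 36, (127) p. 37.  `[Balaban1984PropagatorsI]` (1.72) p. 30.  `[Balaban1984PropagatorsII]` (2.11) p. 225.
`[Balaban1985RegularSpaces]` ("B8") p. 77 (*«we admit the case where some domains Ω_j are equal to T_η»*), (1.7) p. 77, (1.58) p. 86.

CITATION HEADER (lean-in-tree rule).  Cell `pub-ymgap` (YM Track A, HUMAN RULINGS D-0062 ∕ D-0149), node N06 = [B9]; seat `pub-ymgap-dag-n06-b` (g23), junction ∕ letter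
lineage of J-N06→N05 and owner of the N06 object layer of the (β′-PERIODIC) road; CLAIM-4 (own take, pre-announced on the bus 2026-08-28 16:33Z).  WHY.  This seat's
LOCATED-SELF-8 (bus 16:02Z) and dag-n06-w4 g6's independent LOCATED «the limit of the openness road» (bus 16:24Z): the regime class (1.7) on `T_P` CONTAINS FLAT
backgrounds with non-trivial holonomy (`U₀(x,μ) ≡ u_μ`, commuting), at distance `O(1)` from `1` in every periodic gauge; so neither p645632's flat positivity at
`U₀ = 1` nor dag-n06-w4's openness near `1` (`B9Thm311PosDefOpenZdPer`, p648090) reaches them, and a per-member compactness witness of the junction binder `InvAtHIPer`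
∕ `RegularInClassAtHPer` needs Theorem 3.11 AT EVERY FLAT PERIODIC BACKGROUND.  THIS FILE proves it, by the route that avoids the twisted (root-space) Fourier
analysis: §0 a flat configuration on `ℤᵈ` is a pure gauge — its axial gauge ([B7] p. 24, the tree's `axialFn` ∕ `axial_bond_eq`) is trivial — for ANY group, so
(§1) a closed additive cochain on `ℤᵈ` has a potential (the same lemma in `Multiplicative V`), with values in any additive subgroup containing the cochain's
values (Hermitian potentials); §2 the explicit flat composite of a gradient ((3.115) at `U = 1`) and translated block sums; §3 the kernel: gauge `A ↦ Ã = R(u)A` by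
the axial gauge function `u` (quasi-periodic by the holonomies `h_n = u(P•n)`), `Ã = D¹λ̃` on `ℤᵈ`, `Q_m(1)Ã ≡ 0` (the lineage's `linCovIter_rot`) makes
`Q′_m(1)λ̃ ≡ c`, the constants of quasi-periodicity are `λ̃(P•n) = c − R(h_n)c`, so `μ := λ̃ − c` is EXACTLY covariant and `μ^g := R(u)⁻¹μ` is a periodic
element of `N_𝔤^per(Q′(U₀))` (dag-n06-w4's `gaugeNullPer`, via `QprimeIter_gaugeAct`) with `Δ^η_{U₀}μ^g = D^{η*}_{U₀}A` (`covLap_gaugeAct`, `covDivB_gaugeAct`); the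
Landau condition then kills `D^{η*}_{U₀}A` (`projEPer_apply_of_mem_range`), the energy identity on the cell (the lineage's `sum_box_pair_covDerivFwd_left`)
gives `D^η_{U₀}μ^g = 0`, and `A = D^η_{U₀}μ^g` (`covDerivFwd_gaugeAct`); §4 the genuine torus record: with p648517's flat-holonomy kernel conditions,
`⟨A, Δ_a(U₀)A⟩_per ≤ 0 ⟹ A = 0`, positivity, `RegularAtHPer`, and the `torusIdx` reading.

WHAT IS PROVED (kernel, 0 sorry; theorems only (+ five private plumbing lemmas); no `def`, no `instance`, no `notation`).
* §0 (any group `G`) ★ `eq_of_forall_step_eq` (zero steps ⟹ constant on `ℤᵈ`), `hol_plaqWord_gaugeAct_eq_one`, `hol_lplaqWord_eq_one`, `hol_ladder_eq_one`,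
  ★★ `gaugeAct_axialFn_eq_one_of_flat` (FLAT ⟹ PURE GAUGE: the axial gauge of a flat configuration is `1`), ★ `hol_eq_of_gaugeAct_eq_one` (path independence),
  `apply_eq_of_gaugeAct_eq_one`, ★ `gauge_add_period_of_gaugeAct_eq_one` (the gauge function of a periodic pure gauge is quasi-periodic by an
  `x`-independent holonomy).
* §1 `hol_plaqWord_ofAdd`, ★★ `exists_potential_of_closed` (THE POINCARÉ LEMMA ON `ℤᵈ`, any additive fibre, no support ∕ periodicity hypothesis, potential with
  `λ(0) = 0` and values in any additive subgroup containing those of the cochain).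
* §2 ★ `linQIter_grad` ((3.115) for the explicit flat composite, ANY `λ`), `sum_blockSites_add_smul`.
* §3 ★★★ `eq_zero_of_flat_holonomy_kernel` (`U₀` periodic unitary with all plaquettes `1`, `A ∈ domSubHPer P` covariantly closed, `R^per(U₀)D^{η*}_{U₀}A = 0`
  at the all-torus constraint class `torusLam m`, `LᵐηQ_m(U₀)A ≡ 0`, `Lᵐ ∣ P` ⟹ `A = 0`).
* §4 `plaqCovDeriv_eq_zero_of_lt_of_mem_box` (curved periodic twin of dag-n06-w3's), ★★★ `eq_zero_of_flat_of_bondPairPer_deltaAOf_opsAllZdPer_nonpos`,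
  ★★★ `bondPairPer_deltaAOf_opsAllZdPer_pos_of_flat`, ★★ `regularAtHPer_opsAllZdPer_of_flat`, ★★ `regularAtHPer_opsAllZdPer_of_flat_torusIdx`.

HONEST SCOPE.  (i) Theorem 3.11's positivity for the genuine torus record at every FLAT periodic background, all-torus class only; NOT at curved backgrounds (that is
the domination of the signed curvature term, p648517's `regularAtHPer_opsAllZdPer_of_curv_dominated`, resp. dag-n06-w4's openness engine re-based at each flat
background + compactness — successor files), no estimate, no uniformity, no coercivity constant.  (ii) Count-neutral (`--supports` the K1 item of record); N05 ∕ N06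
NOT discharged; K1⁹ NOT closed; counts UNMOVED; one finite `𝕋⁴` programme at fixed `ε`, Bałaban as printed; R4 closes only the conditional finite-`𝕋⁴` rung
`BalabanLadder.UV` — nothing continuum ∕ ℝ⁴ ∕ OS ∕ mass gap ∕ Clay.  Unit `pub-ymgap-dag-n06-b` (g23), 2026-08-28; NEW file importing this seat's
`B9Eq316AveragingSquaresZdPer` (p648517), dag-n06-w3∕w4's `B9Eq333ProjectionCovarianceZd`, lit-balaban's `B9Eq332FieldAvgCovariance`, dag-n05-w3's
`B8Ineq159GaugeCovariance`, `B9Eq340HolderZd`; modifies nothing.  Net new unproved facts: 0.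
-/

noncomputable section

open scoped BigOperators

namespace Literature.MathematicalPhysics.QuantumFieldTheory.Balaban1983to89.B9Thm311FlatHolonomyKernelZdPer

open Literature.MathematicalPhysics.QuantumLattice (blockSites)
open B7Prop1Explicit B7Eq78Linearization
open B7Prop2Explicit (unitaryUnits hol_mem_of)
open B7Prop4GeneralLevels (linCovIter)
open B7Prop4Flat (linQIter)
open B7AvgGaugeCovariance (uLev)
open B8Ineq132 (covDerivFwd covDeriv plaqF)
open B8Eq146AExpansion (plaqCovDeriv)
open B8Eq138LandauZd (covDivB covLap)
open B8LeafModelZd (ZdIdx)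
open B8Eq119TwistedAxial (bgT bgT_one)
open T4TermwiseTorus (IsPeriodic box mem_box tcls tlift tlift_mem_box)
open B9SupplySockB9P3ZdLetters (OpsZd deltaAOf)
open B9Eq327GreenZdHermPer (domSubHPer bondPairPer RegularAtHPer sum_box_pair_covDerivFwd_left isPeriodic_covDerivFwd)
open B9Eq321LandauProjectionZdPer (perSub formPer gaugeNullPer projEPer projRPer isPeriodic_covDivB covLap_mem_rangeGenPer rangeSubPer
  projEPer_apply_of_mem_range)
open B9Eq316AveragingTransposeZd (tauForm tauForm_apply)

-- `Site` alone could resolve to the torus sites of `Setup.lean`; re-export the `ℤ^d` sites of `B7Prop1Explicit`.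
export B7Prop1Explicit (Site)

variable {d : ℕ}

/-! ## §0  Lattice plumbing on `ℤᵈ`: functions with zero steps are constant; flat configurations are pure gauges (any group) -/

section Lattice

/-- ★ **A FUNCTION ON `ℤᵈ` INVARIANT UNDER EVERY UNIT STEP IS CONSTANT** (`ℤᵈ` is connected by unit steps: `x = disp (treeWord x)`).
[cite: Balaban1985Averaging, p.24 (the tree contours `Γ_{y,x}`; bookkeeping)] -/
theorem eq_of_forall_step_eq {β : Sort*} (f : Site d → β) (h : ∀ (x : Site d) (κ : Fin d), f (x + e κ) = f x) (x : Site d) : f x = f 0 := by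
  have hw : ∀ (w : List (Letter d)) (z : Site d), f (z + disp w) = f z := by
    intro w
    induction w with
    | nil => intro z; rw [disp_nil, add_zero]
    | cons l w ih =>
      intro z
      rw [disp_cons, ← add_assoc, ih]
      obtain ⟨κ, b⟩ := l
      cases b
      · -- backward letter: `z + (−e_κ)`
        have h1 := h (z + Letter.vec (κ, false)) κ
        rw [Letter.vec_false, neg_add_cancel_right] at h1
        rw [Letter.vec_false, ← h1]
      · rw [Letter.vec_true, h]
  have := hw (treeWord x) 0
  rwa [disp_treeWord, zero_add] at this

variable {G : Type*} [Group G]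

/-- the plaquette holonomies of a gauge transform are conjugate to those of the configuration; in particular flatness (every plaquette holonomy `= 1`)
is gauge invariant. [cite: Balaban1985Averaging, (8)–(9) p.18, (44) p.24] -/
theorem hol_plaqWord_gaugeAct_eq_one (u : Site d → G) {V : Site d → Fin d → G} (hflat : ∀ (x : Site d) (κ μ : Fin d), κ ≠ μ → hol V x (plaqWord κ μ) = 1)
    (x : Site d) {κ μ : Fin d} (hκμ : κ ≠ μ) : hol (gaugeAct u V) x (plaqWord κ μ) = 1 := by
  rw [hol_gaugeAct_closed u V x _ (disp_plaqWord κ μ), hflat x κ μ hκμ, mul_one, mul_inv_cancel]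

/-- every elementary loop `lplaqWord l μ` (`l.1 ≠ μ`) of a flat configuration has trivial holonomy (the backward letter's loop is a conjugated inverse
plaquette). [cite: Balaban1985Averaging, (44) p.24, pp.24–25] -/
theorem hol_lplaqWord_eq_one {V : Site d → Fin d → G} (hflat : ∀ (x : Site d) (κ μ : Fin d), κ ≠ μ → hol V x (plaqWord κ μ) = 1)
    (x : Site d) (l : Letter d) (μ : Fin d) (hl : l.1 ≠ μ) : hol V x (lplaqWord l μ) = 1 := by
  obtain ⟨κ, b⟩ := l
  cases b
  · have hid : hol V x (lplaqWord (κ, false) μ) = (V (x - e κ) κ)⁻¹ * (hol V (x - e κ) (plaqWord κ μ))⁻¹ * V (x - e κ) κ := by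
      simp only [lplaqWord, plaqWord, hol_cons, hol_nil, mul_one, stepHol_true, stepHol_false, Letter.rev_mk,
        Bool.not_false, Letter.vec_true, Letter.vec_false, mul_inv_rev, inv_inv]
      abel_nf
      group
    rw [hid, hflat _ κ μ hl, inv_one, mul_one, inv_mul_cancel]
  · exact hflat x κ μ hl

/-- the ladder loop over a contour avoiding the direction `μ` has trivial holonomy at a flat configuration. [cite: Balaban1985Averaging, pp.24–25] -/
theorem hol_ladder_eq_one {V : Site d → Fin d → G} (hflat : ∀ (x : Site d) (κ μ : Fin d), κ ≠ μ → hol V x (plaqWord κ μ) = 1) (μ : Fin d) :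
    ∀ (Q : List (Letter d)) (x : Site d), (∀ l ∈ Q, l.1 ≠ μ) → hol V x (ladder Q μ) = 1 := by
  intro Q
  induction Q with
  | nil =>
    intro x _
    rw [hol_ladder, hol_nil, hol_nil, disp_nil, add_zero, one_mul, inv_one, mul_one, mul_inv_cancel]
  | cons l Q ih =>
    intro x hQ
    rw [hol_ladder_cons, ih (x + l.vec) fun l' hl' => hQ l' (List.mem_cons_of_mem l hl'),
      hol_lplaqWord_eq_one hflat x l μ (hQ l List.mem_cons_self)]
    group

/-- ★★ **A FLAT CONFIGURATION ON `ℤᵈ` IS A PURE GAUGE: ITS AXIAL GAUGE IS TRIVIAL** — `(V^{v₀})(b) = 1` at EVERY bond for the axial gauge function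
`v₀ = axialFn V y` of [B7] p. 24 when every plaquette holonomy of `V` is `1` (any group `G`; the lattice `ℤᵈ` is contractible — no holonomy obstruction,
in contrast to the torus): `axial_bond_eq` writes each bond variable as a conjugated ladder holonomy, a product of conjugated plaquette holonomies.
[cite: Balaban1985Averaging, pp.24–25 («V₀(Γ_{y,x}) = 1 … V₀(x, x+e₁) = 1»), (44) p.24] -/
theorem gaugeAct_axialFn_eq_one_of_flat (V : Site d → Fin d → G) (hflat : ∀ (x : Site d) (κ μ : Fin d), κ ≠ μ → hol V x (plaqWord κ μ) = 1)
    (y : Site d) : gaugeAct (axialFn V y) V = 1 := by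
  funext x μ
  obtain ⟨w, Q, hQμ, -, hid⟩ := axial_bond_eq V y x μ
  have hflat' : ∀ (z : Site d) (κ ν : Fin d), κ ≠ ν → hol (gaugeAct (axialFn V y) V) z (plaqWord κ ν) = 1 :=
    fun z κ ν hκν => hol_plaqWord_gaugeAct_eq_one (axialFn V y) hflat z hκν
  rw [hid, hol_ladder_eq_one hflat' μ Q w hQμ, mul_one, inv_mul_cancel]
  rfl

/-- ★ **A PURE GAUGE TRANSPORTS BY ITS GAUGE FUNCTION**: if `V^u = 1` then `V(Γ) = u(Γ₋)⁻¹u(Γ₊)` along EVERY contour — path independence.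
[cite: Balaban1985Averaging, (8)–(9) p.18] -/
theorem hol_eq_of_gaugeAct_eq_one {u : Site d → G} {V : Site d → Fin d → G} (h : gaugeAct u V = 1) (x : Site d) (w : List (Letter d)) :
    hol V x w = (u x)⁻¹ * u (x + disp w) := by
  have h1 := hol_gaugeAct u V x w
  rw [h] at h1
  have h2 : hol (1 : Site d → Fin d → G) x w = 1 := by
    have := hol_mem_of (S := (⊥ : Subgroup G)) (V := (1 : Site d → Fin d → G)) (fun _ _ => Subgroup.mem_bot.2 rfl) x w
    exact Subgroup.mem_bot.1 this
  rw [h2] at h1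
  -- `1 = u x * hol V x w * (u (x + disp w))⁻¹`
  have h3 : u x * hol V x w = u (x + disp w) := by
    have := congrArg (· * u (x + disp w)) h1
    simpa using this.symm
  rw [← h3, inv_mul_cancel_left]

/-- a single bond of a pure gauge: `V(x, x+e_μ) = u(x)⁻¹u(x+e_μ)`. [cite: Balaban1985Averaging, (8) p.18] -/
theorem apply_eq_of_gaugeAct_eq_one {u : Site d → G} {V : Site d → Fin d → G} (h : gaugeAct u V = 1) (x : Site d) (μ : Fin d) :
    V x μ = (u x)⁻¹ * u (x + e μ) := by
  have := congrFun (congrFun h x) μ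
  simp only [gaugeAct, Pi.one_apply] at this
  -- `u x * V x μ * (u (x + e μ))⁻¹ = 1`
  have h2 : u x * V x μ = u (x + e μ) := by
    have := congrArg (· * u (x + e μ)) this
    simpa using this
  rw [← h2, inv_mul_cancel_left]

/-- ★ **THE HOLONOMY OF A PERIODIC PURE GAUGE**: if `V^u = 1` and `V` is `P`-periodic then `u(x + P•n) = u(P•n)·u(0)⁻¹·u(x)` — the gauge function is
quasi-periodic, multiplied on the LEFT by the (x-independent) holonomy `h_n = u(P•n)u(0)⁻¹` of the cycle `n`. [cite: Balaban1985Averaging, (8)–(9) p.18; Balaban1985RegularSpaces, p.77 («Ω_j = T_η»)] -/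
theorem gauge_add_period_of_gaugeAct_eq_one {P : ℕ} {u : Site d → G} {V : Site d → Fin d → G} (h : gaugeAct u V = 1) (hV : IsPeriodic P V)
    (x n : Site d) : u (x + (P : ℤ) • n) = u ((P : ℤ) • n) * (u 0)⁻¹ * u x := by
  -- `x ↦ u(x + P•n)·u(x)⁻¹` has zero steps
  have hstep : ∀ (z : Site d) (κ : Fin d), u (z + e κ + (P : ℤ) • n) * (u (z + e κ))⁻¹ = u (z + (P : ℤ) • n) * (u z)⁻¹ := by
    intro z κ
    have h1 := apply_eq_of_gaugeAct_eq_one h z κ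
    have h2 := apply_eq_of_gaugeAct_eq_one h (z + (P : ℤ) • n) κ
    rw [show V (z + (P : ℤ) • n) κ = V z κ from congrFun (hV z n) κ, h1, add_right_comm] at h2
    -- `h2 : (u z)⁻¹ * u (z + e κ) = (u (z + P•n))⁻¹ * u (z + e κ + P•n)`
    have h3 : u (z + e κ + (P : ℤ) • n) = u (z + (P : ℤ) • n) * ((u z)⁻¹ * u (z + e κ)) := by
      rw [h2, mul_inv_cancel_left]
    rw [h3]
    group
  have hconst := eq_of_forall_step_eq (fun z => u (z + (P : ℤ) • n) * (u z)⁻¹) (fun z κ => by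
    have := hstep z κ
    simpa only using this) x
  -- `hconst : u (x + P•n) * (u x)⁻¹ = u (0 + P•n) * (u 0)⁻¹`
  simp only [zero_add] at hconst
  calc u (x + (P : ℤ) • n) = u (x + (P : ℤ) • n) * (u x)⁻¹ * u x := by rw [inv_mul_cancel_right]
    _ = u ((P : ℤ) • n) * (u 0)⁻¹ * u x := by rw [hconst]

/-- the axial gauge function is `1` at its base point (a private copy of `B8Eq115GaugeFixing.axialFn_self`, to keep the import closure small). [folklore] -/
private theorem axialFn_self' (V : Site d → Fin d → G) (y : Site d) : axialFn V y y = 1 := by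
  simp [axialFn]

end Lattice

/-! ## §1  The additive instance: the Poincaré lemma on `ℤᵈ` for closed bond fields (no support or periodicity hypothesis) -/

section Poincare

variable {V : Type*} [AddCommGroup V]

/-- the plaquette holonomy of the multiplicative reading `ofAdd ∘ φ` of a bond field is `ofAdd` of its circulation.
[cite: Balaban1985BackgroundPropagators, (3.4) p.391 (the plaquette derivative at `U = 1`)] -/
theorem hol_plaqWord_ofAdd (φ : Site d → Fin d → V) (x : Site d) (κ μ : Fin d) :
    hol (fun z ν => Multiplicative.ofAdd (φ z ν)) x (plaqWord κ μ) =
      Multiplicative.ofAdd (φ x κ + φ (x + e κ) μ - φ (x + e μ) κ - φ x μ) := by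
  show stepHol _ x (κ, true) * (stepHol _ (x + e κ) (μ, true) * (stepHol _ (x + e κ + e μ) (κ, false) *
      (stepHol _ (x + e κ + e μ + -e κ) (μ, false) * 1))) = _
  rw [stepHol_true, stepHol_true, stepHol_false, stepHol_false, mul_one,
    show x + e κ + e μ - e κ = x + e μ by abel, show x + e κ + e μ + -e κ - e μ = x by abel,
    ← ofAdd_neg, ← ofAdd_neg, ← ofAdd_add, ← ofAdd_add, ← ofAdd_add]
  congr 1
  abel

/-- ★★ **THE POINCARÉ LEMMA ON `ℤᵈ`** (any additive fibre, NO support or periodicity condition): a CLOSED bond field `φ` (`φ_κ(x) + φ_μ(x+e_κ) = φ_μ(x) +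
φ_κ(x+e_μ)` at every plaquette) is the gradient of a site function `λ` with `λ(0) = 0` and values in any additive subgroup containing the values of `φ`
(so a Hermitian-valued `φ` has a Hermitian potential) — the axial gauge of the multiplicative reading `ofAdd ∘ φ`, which is flat (§0).
[cite: Balaban1985BackgroundPropagators, (3.4) p.391, p.418 («A → A − Dλ»); Balaban1984PropagatorsII, (2.11) p.225; Balaban1985Averaging, pp.24–25] -/
theorem exists_potential_of_closed (φ : Site d → Fin d → V)
    (hclosed : ∀ (x : Site d) (κ μ : Fin d), φ x κ + φ (x + e κ) μ = φ x μ + φ (x + e μ) κ)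
    (S : AddSubgroup V) (hS : ∀ (x : Site d) (κ : Fin d), φ x κ ∈ S) :
    ∃ lam : Site d → V, lam 0 = 0 ∧ (∀ x, lam x ∈ S) ∧ ∀ (x : Site d) (κ : Fin d), lam (x + e κ) - lam x = φ x κ := by
  set W : Site d → Fin d → Multiplicative V := fun z ν => Multiplicative.ofAdd (φ z ν) with hW
  have hflat : ∀ (x : Site d) (κ μ : Fin d), κ ≠ μ → hol W x (plaqWord κ μ) = 1 := by
    intro x κ μ _
    rw [hW, hol_plaqWord_ofAdd]
    have h0 : φ x κ + φ (x + e κ) μ - φ (x + e μ) κ - φ x μ = 0 := by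
      rw [hclosed x κ μ]; abel
    rw [h0]
    rfl
  have hpure := gaugeAct_axialFn_eq_one_of_flat W hflat 0
  refine ⟨fun x => Multiplicative.toAdd (axialFn W 0 x), ?_, fun x => ?_, fun x κ => ?_⟩
  · simp only [axialFn_self']
    rfl
  · have hmem := hol_mem_of (S := AddSubgroup.toSubgroup S) (V := W) (fun z ν => by
      rw [hW]; exact hS z ν) 0 (treeWord (x - 0))
    exact hmem
  · have h1 := apply_eq_of_gaugeAct_eq_one hpure x κ
    -- `W x κ = (g x)⁻¹ * g (x + e κ)` in `Multiplicative V`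
    have h2 := congrArg Multiplicative.toAdd h1
    rw [hW] at h2
    simp only [toAdd_ofAdd, toAdd_mul, toAdd_inv] at h2
    rw [h2]
    abel

end Poincare

/-! ## §2  Flat block calculus: the explicit composite `linQIter` of a gradient; translated block sums -/

section Blocks

variable {𝔸 : Type*} [NormedRing 𝔸] [NormedAlgebra ℂ 𝔸]

/-- ★ **THE FLAT COMPOSITE `Q_j(1)` OF A GRADIENT IS THE COARSE GRADIENT OF THE BLOCK SUM** ([B9] (3.115) «Q_j d = D_j Q′_j» at `U = 1`, for the
EXPLICIT flat composite `B7Prop4Flat.linQIter`, ANY `λ : ℤᵈ → 𝔸` — no boundedness): `linQIter L (c₀·dλ) j (z,κ) = ((Lʲ)ᵈ)⁻¹·c₀·(Σ_{x∈Bʲ(z+e_κ)}λ(x) −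
Σ_{x∈Bʲ(z)}λ(x))` — telescoping along the straight contours of (125) and the block dictionary `B7Eq214FlatQprime.sum_blockSites_eq_sum_boxVec`.
[cite: Balaban1985BackgroundPropagators, (3.115) p.418; Balaban1985Averaging, (122) + (125) p.36, (127) p.37; Balaban1984PropagatorsI, (1.18) p.20] -/
theorem linQIter_grad (L : ℕ) (c₀ : ℂ) (lam : Site d → 𝔸) (j : ℕ) (z : Site d) (κ : Fin d) :
    linQIter L (fun (y : Site d) (τ : Fin d) => c₀ • (lam (y + e τ) - lam y)) j z κ =
      ((((L ^ j : ℕ) : ℝ) ^ d)⁻¹ : ℝ) • (c₀ • (∑ x ∈ blockSites (L ^ j) (z + e κ), lam x - ∑ x ∈ blockSites (L ^ j) z, lam x)) := by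
  rw [B7Prop4Flat.linQIter_eq_linQ_pow, B7Prop4Flat.linQ_eq_sum]
  have htel : ∀ p : Site d, ∑ i : Fin (L ^ j), c₀ • (lam (p + ((i : ℕ) : ℤ) • e κ + e κ) - lam (p + ((i : ℕ) : ℤ) • e κ)) =
      c₀ • (lam (p + ((L ^ j : ℕ) : ℤ) • e κ) - lam p) := by
    intro p
    have hshift : ∀ i : ℕ, p + (i : ℤ) • e κ + e κ = p + ((i + 1 : ℕ) : ℤ) • e κ := by
      intro i; push_cast; rw [add_smul, one_smul, add_assoc]
    rw [← Finset.smul_sum, Fin.sum_univ_eq_sum_range (fun i : ℕ => lam (p + (i : ℤ) • e κ + e κ) - lam (p + (i : ℤ) • e κ)) (L ^ j)]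
    simp_rw [hshift]
    rw [Finset.sum_range_sub (fun i : ℕ => lam (p + (i : ℤ) • e κ)) (L ^ j)]
    simp
  simp_rw [htel]
  rw [← Finset.smul_sum, ← Finset.smul_sum, Finset.sum_sub_distrib,
    B7Eq214FlatQprime.sum_blockSites_eq_sum_boxVec (L ^ j) (z + e κ) lam, B7Eq214FlatQprime.sum_blockSites_eq_sum_boxVec (L ^ j) z lam]
  congr 3
  refine Finset.sum_congr rfl fun r _ => ?_
  congr 1
  rw [smul_add]
  abel

/-- a block translated by `Q•n` on the `N`-lattice is the block translated by `(N·Q)•n` on the fine lattice. [cite: Balaban1985Averaging, (2)–(3) p.17 (bookkeeping)] -/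
theorem sum_blockSites_add_smul {β : Type*} [AddCommMonoid β] (N : ℕ) (Q : ℤ) (y n : Site d) (g : Site d → β) :
    ∑ x ∈ blockSites N (y + Q • n), g x = ∑ x ∈ blockSites N y, g (x + ((N : ℤ) * Q) • n) := by
  rw [B7Eq214FlatQprime.sum_blockSites_eq_sum_boxVec, B7Eq214FlatQprime.sum_blockSites_eq_sum_boxVec]
  refine Finset.sum_congr rfl fun r _ => ?_
  congr 1
  rw [smul_add, ← smul_smul]
  abel

end Blocks

/-! ## §3  [B9] Theorem 3.11's kernel at a flat periodic background with ARBITRARY holonomy -/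

section Kernel

variable {𝔸 : Type*} [CStarAlgebra 𝔸] (τ : 𝔸 →ₗ[ℂ] ℂ) [FiniteDimensional ℝ 𝔸] [Nontrivial 𝔸] {L : ℕ} (P : ℕ) [NeZero P]

omit [FiniteDimensional ℝ 𝔸] [Nontrivial 𝔸] in
/-- `R(g)0 = 0`. [folklore] -/
private theorem conjR_zero' (g : 𝔸ˣ) : conjR g (0 : 𝔸) = 0 := by
  simp [conjR_apply]

omit [FiniteDimensional ℝ 𝔸] [Nontrivial 𝔸] in
/-- a real multiple of a Hermitian element is Hermitian. [cite: Balaban1985BackgroundPropagators, p.391 (𝔤-valued fields; bookkeeping)] -/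
private theorem smul_real_mem_selfAdjoint (r : ℝ) {a : 𝔸} (ha : IsSelfAdjoint a) : r • a ∈ selfAdjoint 𝔸 := by
  rw [selfAdjoint.mem_iff, ← Complex.coe_smul, star_smul, Complex.star_def, Complex.conj_ofReal, ha.star_eq]

/-- ★★★ **[B9] THEOREM 3.11's KERNEL AT A FLAT PERIODIC BACKGROUND WITH ARBITRARY HOLONOMY** (the all-torus constraint class `torusLam m` of [B8] p. 77,
`Lᵐ ∣ P`): for a `P`-periodic unitary `U₀` with every plaquette variable `1` — NOT assumed gauge-equivalent to `1` (constant commuting backgrounds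
`U₀(x,μ) = u_μ` are included) — a field `A ∈ E_𝔤^per(P)` that is (a) covariantly closed, (b) has vanishing periodic Landau projection `R^per(U₀)(D^{η*}_{U₀}A) = 0`,
and (c) has `LᵐηQ_m(U₀)A ≡ 0`, VANISHES.  ROUTE: `U₀` is a pure gauge `g⁻¹dg` on the contractible lattice `ℤᵈ` (§0), `g` quasi-periodic by the holonomies;
the transformed field `Ã = R(g)A` is flat-closed on `ℤᵈ`, hence `Ã = D¹λ̃` (§1, Hermitian `λ̃`); (c) and [B9] (3.115) (§2) make `Q′_m(1)λ̃ ≡ c` constant;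
`μ := λ̃ − c` is then EXACTLY covariant-quasi-periodic and `Q′(1)`-null, so `μ^g := R(g)⁻¹μ` is a periodic element of `N_𝔤^per(Q′(U₀))` with
`Δ^η_{U₀}μ^g = D^{η*}_{U₀}A`; so `D^{η*}_{U₀}A` lies in the range of `R^per(U₀)` and (b) kills it; the energy identity on the cell gives `D^η_{U₀}μ^g = 0`,
i.e. `A = 0`.  (The twisted Hodge theorem print's «Δ_a positive definite» needs at these backgrounds.)
[cite: Balaban1985BackgroundPropagators, Thm 3.11 p.416, (3.21)–(3.23) p.394, (3.26)–(3.27) p.395, (3.32)–(3.34) pp.395–396, (3.115) p.418; Balaban1984PropagatorsI, (1.72) p.30; Balaban1985Averaging, (8)–(11) pp.18–19, pp.24–25; Balaban1985RegularSpaces, p.77 («Ω_j = T_η»)] -/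
theorem eq_zero_of_flat_holonomy_kernel (hτt : ∀ a b : 𝔸, τ (a * b) = τ (b * a))
    (hτs : ∀ a : 𝔸, τ (star a) = starRingEnd ℂ (τ a)) (hτp : ∀ a : 𝔸, a ≠ 0 → 0 < (τ (star a * a)).re)
    (hL : 1 ≤ L) {η : ℝ} (hη : η ≠ 0) {m : ℕ} (hdvd : L ^ m ∣ P)
    {U₀ : Site d → Fin d → 𝔸ˣ} (hU₀ : ∀ x κ, U₀ x κ ∈ unitaryUnits 𝔸) (hU : IsPeriodic P U₀)
    (hflat : ∀ (κ ν : Fin d) (x : Site d), plaqF U₀ κ ν x = 1)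
    {A : Site d → Fin d → 𝔸} (hA : A ∈ domSubHPer (d := d) (𝔸 := 𝔸) P)
    (ha : ∀ (μ ν : Fin d) (x : Site d), plaqCovDeriv η U₀ A μ ν x = 0)
    (hb : projRPer τ P L m η (B8Thm4TorusAt.torusLam m) U₀ (covDivB η U₀ A) = 0)
    (hc : ∀ (y : Site d) (κ : Fin d), linCovIter L U₀ A m y κ = 0) : A = 0 := by
  classical
  have hU₀1 : ∀ x κ, U₀ x κ ∈ U1 𝔸 := fun x κ => B7Prop2Explicit.unitaryUnits_le_U1 (hU₀ x κ)
  -- (A) the axial gauge trivialises the flat background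
  set u : Site d → 𝔸ˣ := axialFn U₀ 0 with hu
  have hflatH : ∀ (x : Site d) (κ μ : Fin d), κ ≠ μ → hol U₀ x (plaqWord κ μ) = 1 := by
    intro x κ μ _
    exact Units.ext (by rw [Units.val_one]; exact hflat κ μ x)
  have hpure : gaugeAct u U₀ = 1 := gaugeAct_axialFn_eq_one_of_flat U₀ hflatH 0
  have huU : ∀ x, u x ∈ unitaryUnits 𝔸 := fun x => hol_mem_of hU₀ 0 _
  have huinvU : ∀ x, u⁻¹ x ∈ unitaryUnits 𝔸 := B9Eq333ProjectionCovarianceZd.inv_mem_unitaryUnits huU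
  have hu0 : u 0 = 1 := axialFn_self' U₀ 0
  have hU₀eq : U₀ = gaugeAct u⁻¹ (1 : Site d → Fin d → 𝔸ˣ) := by
    rw [← hpure, B9Eq333ProjectionCovarianceZd.gaugeAct_inv_gaugeAct]
  -- the holonomies of the cycles
  set h : Site d → 𝔸ˣ := fun n => u ((P : ℤ) • n) with hh
  have huper : ∀ (x n : Site d), u (x + (P : ℤ) • n) = h n * u x := by
    intro x n; rw [gauge_add_period_of_gaugeAct_eq_one hpure hU x n, hu0, inv_one, mul_one]
  -- (B) the transformed field `Ã = R(u)A` on `ℤᵈ`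
  set At : Site d → Fin d → 𝔸 := fun x κ => conjR (u x) (A x κ) with hAt
  have hAt_sa : ∀ x κ, IsSelfAdjoint (At x κ) := fun x κ => B9Eq333ProjectionCovarianceZd.isSelfAdjoint_conjR (huU x) (hA.2 x κ)
  have hAt_per : ∀ (x n : Site d) (κ : Fin d), At (x + (P : ℤ) • n) κ = conjR (h n) (At x κ) := by
    intro x n κ
    simp only [hAt]
    rw [show A (x + (P : ℤ) • n) κ = A x κ from congrFun (hA.1 x n) κ, huper, ← B8Ineq132.conjR_conjR]
  have hAt_closed : ∀ (μ ν : Fin d) (x : Site d), plaqCovDeriv η (1 : Site d → Fin d → 𝔸ˣ) At μ ν x = 0 := by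
    intro μ ν x
    have h1 := B8Ineq159GaugeCovariance.plaqCovDeriv_gaugeAct η u U₀ A μ ν x
    rw [hpure] at h1
    rw [hAt, h1, ha, conjR_zero']
  have hAt_lin : ∀ (z : Site d) (κ : Fin d), linCovIter L (1 : Site d → Fin d → 𝔸ˣ) At m z κ = 0 := by
    intro z κ
    have h1 := B9Eq332FieldAvgCovariance.linCovIter_rot L u U₀ A m z κ
    rw [hpure] at h1
    rw [hAt, h1, hc, conjR_zero']
  -- closedness in difference form
  have hdiff : ∀ (x : Site d) (κ μ : Fin d), η • At x κ + η • At (x + e κ) μ = η • At x μ + η • At (x + e μ) κ := by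
    intro x κ μ
    have h0 := hAt_closed κ μ x
    rw [B8Eq146AExpansion.plaqCovDeriv_eq_covDerivFwd, B8Eq191FlatStencils.covDerivFwd_flat_apply, B8Eq191FlatStencils.covDerivFwd_flat_apply,
      ← smul_sub, smul_eq_zero] at h0
    have h1 : At (x + e κ) μ - At x μ - (At (x + e μ) κ - At x κ) = 0 := h0.resolve_left (inv_ne_zero hη)
    rw [← smul_add, ← smul_add]
    congr 1
    rw [← sub_eq_zero]
    rw [← sub_eq_zero] at h1
    rw [← h1]
    abel
  -- (F) the Hermitian potential on `ℤᵈ`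
  obtain ⟨lt, hlt0, hltS, hgrad⟩ := exists_potential_of_closed (fun x κ => η • At x κ) hdiff (selfAdjoint 𝔸)
    (fun x κ => smul_real_mem_selfAdjoint η (hAt_sa x κ))
  have hgrad' : ∀ (x : Site d) (κ : Fin d), covDerivFwd η (1 : Site d → Fin d → 𝔸ˣ) κ lt x = At x κ := by
    intro x κ
    rw [B8Eq191FlatStencils.covDerivFwd_flat_apply, hgrad x κ, smul_smul, inv_mul_cancel₀ hη, one_smul]
  have hAt_eq : At = fun x κ => ((η⁻¹ : ℝ) : ℂ) • (lt (x + e κ) - lt x) := by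
    funext x κ
    rw [Complex.coe_smul, hgrad x κ, smul_smul, inv_mul_cancel₀ hη, one_smul]
  -- (G) the block sums of `λ̃` are constant
  set N : ℕ := L ^ m with hN
  have hN0 : 0 < N := pow_pos (by omega) m
  set S : Site d → 𝔸 := fun z => ∑ x ∈ blockSites N z, lt x with hS
  have hSstep : ∀ (z : Site d) (κ : Fin d), S (z + e κ) = S z := by
    intro z κ
    obtain ⟨M₀, hM₀, hAM⟩ := B9Thm311FlatPositivityZdPer.exists_bound_of_isPeriodic_bond P hA.1
    have hAtb : ∀ x κ', ‖At x κ'‖ ≤ M₀ := fun x κ' => by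
      simp only [hAt]; rw [B8Ineq132.norm_conjR (B7Prop2Explicit.unitaryUnits_le_U1 (huU x))]; exact hAM x κ'
    have h1 := hAt_lin z κ
    rw [congrFun (congrFun (B9Eq316TowerFlatIsOneStep.linCovIter_one_left L hL At hM₀ hAtb m) z) κ, hAt_eq,
      linQIter_grad L _ lt m z κ, smul_eq_zero, smul_eq_zero] at h1
    rcases h1 with h1 | h1 | h1
    · exfalso
      have : (0 : ℝ) < (((L ^ m : ℕ) : ℝ) ^ d)⁻¹ := by positivity
      exact this.ne' h1
    · exfalso
      have : ((η⁻¹ : ℝ) : ℂ) ≠ 0 := by exact_mod_cast inv_ne_zero hη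
      exact this h1
    · exact (sub_eq_zero.1 h1)
  have hSconst : ∀ z : Site d, S z = S 0 := eq_of_forall_step_eq S hSstep
  -- the flat average `Q′_m(1)λ̃` is the constant `c`
  set c : 𝔸 := (((L : ℝ) ^ (m * d))⁻¹ : ℝ) • S 0 with hcdef
  have hQ'lt : ∀ y : Site d, QprimeIter (zdBlocking d L) (bgT L (1 : Site d → Fin d → 𝔸ˣ)) m lt y = c := by
    intro y
    rw [bgT_one, B7Eq214FlatQprime.QprimeIter_one_eq_sum_blockSites hL lt m y, ← Finset.smul_sum]
    show (((L : ℝ) ^ (m * d))⁻¹ : ℝ) • S y = c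
    rw [hSconst y]
  -- (H) the quasi-periodicity constants: `λ̃(x + P•n) = R(h_n)λ̃(x) + λ̃(P•n)` and `λ̃(P•n) = c − R(h_n)c`
  have hlt_per : ∀ (x n : Site d), lt (x + (P : ℤ) • n) = conjR (h n) (lt x) + lt ((P : ℤ) • n) := by
    intro x n
    have hstep : ∀ (z : Site d) (κ : Fin d),
        lt (z + e κ + (P : ℤ) • n) - conjR (h n) (lt (z + e κ)) = lt (z + (P : ℤ) • n) - conjR (h n) (lt z) := by
      intro z κ
      have h1 := hgrad (z + (P : ℤ) • n) κ
      have h2 := hgrad z κ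
      rw [add_right_comm] at h1
      -- `lt (z + eκ + Pn) = lt (z + Pn) + η•Ã(z+Pn) = lt(z+Pn) + R(h)(η•Ã z)`
      have e1 : lt (z + e κ + (P : ℤ) • n) = lt (z + (P : ℤ) • n) + η • At (z + (P : ℤ) • n) κ := by
        rw [← h1]; abel
      have e2 : lt (z + e κ) = lt z + η • At z κ := by rw [← h2]; abel
      rw [e1, e2, conjR_add, conjR_smul_real, hAt_per]
      abel
    have := eq_of_forall_step_eq (fun z => lt (z + (P : ℤ) • n) - conjR (h n) (lt z)) hstep x
    simp only [zero_add, hlt0, conjR_zero', sub_zero] at this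
    rw [← this]
    abel
  have hltPn : ∀ n : Site d, lt ((P : ℤ) • n) = c - conjR (h n) c := by
    intro n
    set Q : ℕ := P / L ^ m with hQ
    have hPQ : (P : ℤ) = (N : ℤ) * (Q : ℤ) := by
      rw [hN, hQ]; exact_mod_cast (Nat.mul_div_cancel' hdvd).symm
    -- `S(Q•n) = R(h_n)S(0) + Nᵈ·λ̃(P•n)`
    have h1 : S ((Q : ℤ) • n) = conjR (h n) (S 0) + (N ^ d : ℕ) • lt ((P : ℤ) • n) := by
      have h0 := sum_blockSites_add_smul N (Q : ℤ) 0 n lt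
      rw [zero_add, ← hPQ] at h0
      show ∑ x ∈ blockSites N ((Q : ℤ) • n), lt x = conjR (h n) (∑ x ∈ blockSites N 0, lt x) + (N ^ d : ℕ) • lt ((P : ℤ) • n)
      rw [h0]
      simp_rw [hlt_per _ n]
      rw [Finset.sum_add_distrib, B8Ineq132.conjR_sum, Finset.sum_const, Literature.MathematicalPhysics.QuantumLattice.card_blockSites]
    rw [hSconst] at h1
    -- solve for `λ̃(P•n)`
    have hNd : (((N ^ d : ℕ) : ℝ)) ≠ 0 := by positivity
    have h2 : (N ^ d : ℕ) • lt ((P : ℤ) • n) = S 0 - conjR (h n) (S 0) := by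
      rw [eq_sub_iff_add_eq, add_comm, ← h1]
    have h3 : lt ((P : ℤ) • n) = (((N ^ d : ℕ) : ℝ)⁻¹ : ℝ) • (S 0 - conjR (h n) (S 0)) := by
      rw [← h2, ← Nat.cast_smul_eq_nsmul ℝ, smul_smul, inv_mul_cancel₀ hNd, one_smul]
    rw [h3, hcdef, conjR_smul_real, ← smul_sub]
    congr 1
    rw [hN]; push_cast; rw [← pow_mul]
  -- `μ := λ̃ − c` is exactly covariant
  set μf : Site d → 𝔸 := fun x => lt x - c with hμf
  have hμ_per : ∀ (x n : Site d), μf (x + (P : ℤ) • n) = conjR (h n) (μf x) := by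
    intro x n
    simp only [hμf]
    rw [hlt_per, hltPn, conjR_sub]
    abel
  have hcS : c ∈ selfAdjoint 𝔸 := by
    rw [hcdef]
    have hS0 : IsSelfAdjoint (S 0) := by
      show IsSelfAdjoint (∑ x ∈ blockSites N 0, lt x)
      rw [IsSelfAdjoint, star_sum]
      exact Finset.sum_congr rfl fun x _ => (hltS x).star_eq
    exact smul_real_mem_selfAdjoint _ hS0
  have hμ_sa : ∀ x, IsSelfAdjoint (μf x) := fun x => (hltS x).sub hcS
  have hμ_null : ∀ y : Site d, QprimeIter (zdBlocking d L) (bgT L (1 : Site d → Fin d → 𝔸ˣ)) m μf y = 0 := by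
    intro y
    haveI : NeZero L := ⟨by omega⟩
    have hsplit : μf = fun x => lt x + (fun _ : Site d => -c) x := by
      funext x; simp only [hμf, sub_eq_add_neg]
    rw [hsplit, QprimeIter_add]
    show QprimeIter (zdBlocking d L) (bgT L 1) m lt y + QprimeIter (zdBlocking d L) (bgT L 1) m (fun _ => -c) y = 0
    rw [hQ'lt, B9Eq324DeltaPrimeAZdPer.qprimeIter_one_const hL (-c) m y, add_neg_cancel]
  -- (I) gauge back: `μ^g := R(u)⁻¹μ` is a periodic element of `N_𝔤^per(Q′(U₀))`
  set μg : Site d → 𝔸 := fun x => conjR (u⁻¹ x) (μf x) with hμg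
  have hμg_per : IsPeriodic P μg := by
    intro x n
    simp only [hμg, Pi.inv_apply]
    rw [hμ_per, huper, B8Ineq132.conjR_conjR, mul_inv_rev, inv_mul_cancel_right]
  have hμg_sa : ∀ x, IsSelfAdjoint (μg x) := fun x => B9Eq333ProjectionCovarianceZd.isSelfAdjoint_conjR (huinvU x) (hμ_sa x)
  have hμg_null : μg ∈ gaugeNullPer P L m (B8Thm4TorusAt.torusLam m) U₀ := by
    refine ⟨hμg_sa, hμg_per, fun j _ y hy => ?_⟩
    have hjm : j = m := (B8Thm4TorusAt.mem_torusLam_iff m j y).1 hy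
    subst hjm
    rw [hU₀eq, B9Eq333ProjectionCovarianceZd.QprimeIter_gaugeAct L u⁻¹ (1 : Site d → Fin d → 𝔸ˣ) j μf y, hμ_null, conjR_zero']
  -- (J) `Δ^η_{U₀}μ^g = D^{η*}_{U₀}A`, so the Landau condition (b) kills `D^{η*}_{U₀}A`
  have hlap : ∀ x : Site d, covLap η U₀ μg x = covDivB η U₀ A x := by
    intro x
    have h1 := B8Ineq159GaugeCovariance.covLap_gaugeAct η u⁻¹ (1 : Site d → Fin d → 𝔸ˣ) μf x
    rw [← hU₀eq] at h1
    have h2 : covLap η (1 : Site d → Fin d → 𝔸ˣ) μf x = covDivB η (1 : Site d → Fin d → 𝔸ˣ) At x := by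
      simp only [covLap, hμf, B9Thm311FlatKernelZdPer.covDerivFwd_one_sub_const, hgrad']
    have h3 := B8Ineq159GaugeCovariance.covDivB_gaugeAct η u U₀ A x
    rw [hpure] at h3
    show covLap η U₀ (fun z => conjR (u⁻¹ z) (μf z)) x = covDivB η U₀ A x
    rw [h1, h2, show (fun z κ => conjR (u z) (A z κ)) = At from rfl] at *
    rw [h3, Pi.inv_apply, B8Ineq132.conjR_conjR, inv_mul_cancel, B8Ineq132.one_conjR]
  have hdivA : covDivB η U₀ A = 0 := by
    have hmem : (⟨covDivB η U₀ A, isPeriodic_covDivB hU hA.1⟩ : perSub (𝔸 := 𝔸) (d := d) P) ∈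
        rangeSubPer P L m η (B8Thm4TorusAt.torusLam m) U₀ := by
      have hgen := covLap_mem_rangeGenPer (η := η) hU hμg_null
      have heq : (⟨covLap η U₀ μg, B9Eq321LandauProjectionZdPer.covLap_mem_perSub hU hμg_null.2.1⟩ : perSub (𝔸 := 𝔸) (d := d) P) =
          ⟨covDivB η U₀ A, isPeriodic_covDivB hU hA.1⟩ := Subtype.ext (funext hlap)
      rw [← heq]
      exact Submodule.subset_span hgen
    have hproj := B9Thm311FlatPositivityZdPer.projRPer_covDivB_eq_coe τ P L m η (B8Thm4TorusAt.torusLam m) hU hA.1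
    rw [hb, projEPer_apply_of_mem_range L m η (B8Thm4TorusAt.torusLam m) U₀ hτs hτp hmem] at hproj
    exact hproj.symm
  have hlap0 : ∀ x, covLap η U₀ μg x = 0 := fun x => by rw [hlap, hdivA, Pi.zero_apply]
  -- (K) the energy identity on the cell: `D^η_{U₀}μ^g = 0`
  have hB : ∀ v ∈ unitaryUnits 𝔸, ∀ a b : 𝔸, tauForm τ (conjR v a) b = tauForm τ a (conjR v⁻¹ b) :=
    fun v hv a b => by rw [tauForm_apply, tauForm_apply]; exact B9Eq326GaugeTermSquareZd.re_trace_star_pair_invariant τ hτt hv a b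
  have henergy : ∑ κ : Fin d, ∑ x ∈ box (d := d) P, tauForm τ (covDerivFwd η U₀ κ μg x) (covDerivFwd η U₀ κ μg x) =
      ∑ x ∈ box (d := d) P, tauForm τ (μg x) (covLap η U₀ μg x) := by
    have hsplit : ∀ x, tauForm τ (μg x) (covLap η U₀ μg x) =
        ∑ κ : Fin d, tauForm τ (μg x) (covDeriv η U₀ κ (fun z => covDerivFwd η U₀ κ μg z) x) := by
      intro x
      simp only [covLap, covDivB, map_sum]
    calc ∑ κ : Fin d, ∑ x ∈ box (d := d) P, tauForm τ (covDerivFwd η U₀ κ μg x) (covDerivFwd η U₀ κ μg x)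
        = ∑ κ : Fin d, ∑ x ∈ box (d := d) P, tauForm τ (μg x) (covDeriv η U₀ κ (fun z => covDerivFwd η U₀ κ μg z) x) :=
          Finset.sum_congr rfl fun κ _ =>
            sum_box_pair_covDerivFwd_left (tauForm τ) (unitaryUnits 𝔸) P η U₀ hB κ (fun x => hU₀ x κ) hU hμg_per
              (isPeriodic_covDerivFwd η hU κ hμg_per)
      _ = ∑ x ∈ box (d := d) P, ∑ κ : Fin d, tauForm τ (μg x) (covDeriv η U₀ κ (fun z => covDerivFwd η U₀ κ μg z) x) := Finset.sum_comm
      _ = ∑ x ∈ box (d := d) P, tauForm τ (μg x) (covLap η U₀ μg x) := Finset.sum_congr rfl fun x _ => (hsplit x).symm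
  have hDμg : ∀ (κ : Fin d) (x : Site d), covDerivFwd η U₀ κ μg x = 0 := by
    have nn := B9Thm311FlatHermKernelZd.re_trace_star_mul_self_nonneg' (τ := τ) hτp
    have hz : ∑ κ : Fin d, ∑ x ∈ box (d := d) P, tauForm τ (covDerivFwd η U₀ κ μg x) (covDerivFwd η U₀ κ μg x) = 0 := by
      rw [henergy]
      exact Finset.sum_eq_zero fun x _ => by rw [hlap0, map_zero]
    simp only [tauForm_apply] at hz
    intro κ x
    have hper := isPeriodic_covDerivFwd η hU κ hμg_per
    rw [← hper.apply_tlift x]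
    have h1 := (Finset.sum_eq_zero_iff_of_nonneg fun κ _ => Finset.sum_nonneg fun x _ => nn _).1 hz κ (Finset.mem_univ κ)
    have h2 := (Finset.sum_eq_zero_iff_of_nonneg fun x _ => nn _).1 h1 _ (tlift_mem_box (tcls P x))
    exact B9Thm311FlatHermKernelZd.eq_zero_of_re_trace_star_mul_self_eq_zero hτp h2
  -- (L) `A = D^η_{U₀}μ^g = 0`
  funext x κ
  have h1 := B9Eq340HolderZd.covDerivFwd_gaugeAct η u⁻¹ (1 : Site d → Fin d → 𝔸ˣ) κ (F := μf) (Fu := μg) (fun z => rfl) x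
  rw [← hU₀eq, hDμg] at h1
  have h2 : covDerivFwd η (1 : Site d → Fin d → 𝔸ˣ) κ μf x = At x κ := by
    simp only [hμf]
    rw [B9Thm311FlatKernelZdPer.covDerivFwd_one_sub_const, hgrad']
  rw [h2, hAt, Pi.inv_apply, B8Ineq132.conjR_conjR, inv_mul_cancel, B8Ineq132.one_conjR] at h1
  rw [← h1, Pi.zero_apply, Pi.zero_apply]

end Kernel

/-! ## §4  The genuine torus record `opsAllZdPer` at a flat background with arbitrary holonomy: kernel, positivity, `RegularAtHPer` -/

section Record

variable {𝔸 : Type*} [CStarAlgebra 𝔸] (τ : 𝔸 →ₗ[ℂ] ℂ) [FiniteDimensional ℝ 𝔸] [Nontrivial 𝔸] {L : ℕ} (P : ℕ) [NeZero P]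

open B9SupplySockB9P3ZdAllLettersZdPer (opsAllZdPer opsLandauPer regularAtHPer_opsAllZdPer_of_pos)
open B9SupplySockB9P3ZdGammaInAkDpZd (withDpZd)
open B9Eq316AveragingTransposeZdPrinted (withQQP)
open B9Eq326DeltaAPeriodicLettersZd (linCovIter_add_period)

omit [CStarAlgebra 𝔸] [FiniteDimensional ℝ 𝔸] [Nontrivial 𝔸] [NeZero P] in
/-- `P = Lᵐ·(P ∕ Lᵐ)` over `ℤ`. [folklore] -/
private theorem cast_eq_pow_mul_div'' {m : ℕ} (hdvd : L ^ m ∣ P) : (P : ℤ) = (L : ℤ) ^ m * ((P / L ^ m : ℕ) : ℤ) := by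
  exact_mod_cast (Nat.mul_div_cancel' hdvd).symm

omit [CStarAlgebra 𝔸] [FiniteDimensional ℝ 𝔸] [Nontrivial 𝔸] in
/-- the coarse period `P ∕ Lᵐ` is non-zero. [folklore] -/
private theorem neZero_div'' {m : ℕ} (hdvd : L ^ m ∣ P) : NeZero (P / L ^ m) := by
  refine ⟨(Nat.div_pos (Nat.le_of_dvd (Nat.pos_of_ne_zero (NeZero.ne P)) hdvd) ?_).ne'⟩
  rcases Nat.eq_zero_or_pos (L ^ m) with h0 | hpos
  · exfalso
    have : (0 : ℕ) ∣ P := by rw [← h0]; exact hdvd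
    exact NeZero.ne P (Nat.eq_zero_of_zero_dvd this)
  · exact hpos

omit [FiniteDimensional ℝ 𝔸] [Nontrivial 𝔸] in
/-- **CLOSEDNESS EVERYWHERE FROM CLOSEDNESS ON THE CELL'S PLAQUETTES `ν < κ`** at a periodic background, for a periodic field (antisymmetry of (3.4), empty
diagonal, periodicity — dag-n06-w3's `plaqCovDeriv_one_eq_zero_of_lt_of_mem_box` at a general `U₀`). [cite: Balaban1985BackgroundPropagators, (3.4) p.391; Balaban1985RegularSpaces, p.77 («Ω_j = T_η»)] -/
theorem plaqCovDeriv_eq_zero_of_lt_of_mem_box {η : ℝ} {U₀ : Site d → Fin d → 𝔸ˣ} (hU : IsPeriodic P U₀) {A : Site d → Fin d → 𝔸} (hA : IsPeriodic P A)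
    (h : ∀ (κ : Fin d), ∀ ν ∈ Finset.Iio κ, ∀ x ∈ box (d := d) P, plaqCovDeriv η U₀ A ν κ x = 0)
    (μ ν : Fin d) (x : Site d) : plaqCovDeriv η U₀ A μ ν x = 0 := by
  have hper : IsPeriodic P (plaqCovDeriv η U₀ A μ ν) := B9Eq327GreenZdHermPer.isPeriodic_plaqCovDeriv η hU hA μ ν
  rw [← hper.apply_tlift x]
  have hx : tlift (tcls P x) ∈ box (d := d) P := tlift_mem_box _
  rcases lt_trichotomy μ ν with hlt | rfl | hgt
  · exact h ν μ (Finset.mem_Iio.2 hlt) _ hx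
  · rw [B8Eq146AExpansion.plaqCovDeriv_eq_covDerivFwd, sub_self]
  · have h1 := h μ ν (Finset.mem_Iio.2 hgt) _ hx
    rw [B8Eq146AExpansion.plaqCovDeriv_eq_covDerivFwd] at h1 ⊢
    rw [← neg_sub, h1, neg_zero]

/-- ★★★ **[B9] THEOREM 3.11 AT EVERY FLAT PERIODIC BACKGROUND OF THE TORUS — THE KERNEL FOR THE GENUINE RECORD**: at a member with the all-torus classes
(`i.Λs m = torusLam m`, `ΛbP m = torusLamb m`), `Lᵐ ∣ P`, `L ≥ 2`, a faithful Hermitian tracial `τ` on a finite-dimensional fibre, a `P`-periodic unitary `U₀`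
with EVERY PLAQUETTE VARIABLE `1` (ANY holonomy), and `A ∈ E_𝔤^per(P)` with `⟨A, Δ_a(U₀)A⟩_per ≤ 0` for the genuine torus record `opsAllZdPer`: `A = 0` — the
lineage's flat-holonomy kernel conditions (p648517) upgraded to all of `ℤᵈ` by periodicity, then §3.
[cite: Balaban1985BackgroundPropagators, Thm 3.11 p.416, (3.26)–(3.27) p.395; Balaban1984PropagatorsI, (1.72) p.30; Balaban1985RegularSpaces, p.77 («Ω_j = T_η»)] -/
theorem eq_zero_of_flat_of_bondPairPer_deltaAOf_opsAllZdPer_nonpos (hτt : ∀ a b : 𝔸, τ (a * b) = τ (b * a))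
    (hτs : ∀ a : 𝔸, τ (star a) = starRingEnd ℂ (τ a)) (hτp : ∀ a : 𝔸, a ≠ 0 → 0 < (τ (star a * a)).re)
    (hL : 2 ≤ L) (ops₀ : ℝ → ZdIdx d L → ℕ → OpsZd d 𝔸) (M : ℝ) (i : ZdIdx d L) {m : ℕ}
    (hΛs : i.Λs m = B8Thm4TorusAt.torusLam m) {ΛbP : ℕ → ℕ → Set (Site d × Fin d)} (hΛb : ΛbP m = B8Thm2TorusMember.torusLamb m)
    (hΩ : ∀ j, i.Ω j = Set.univ) (hdvd : L ^ m ∣ P) {U₀ : Site d → Fin d → 𝔸ˣ} (hU₀ : ∀ x κ, U₀ x κ ∈ unitaryUnits 𝔸) (hU : IsPeriodic P U₀)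
    (hflat : ∀ (κ ν : Fin d) (x : Site d), plaqF U₀ κ ν x = 1)
    {A : Site d → Fin d → 𝔸} (hA : A ∈ domSubHPer (d := d) (𝔸 := 𝔸) P)
    (h : bondPairPer τ P A (deltaAOf i.η (opsAllZdPer τ L P ΛbP ops₀ M i m) U₀ A) ≤ 0) : A = 0 := by
  have hL1 : 1 ≤ L := le_trans (by norm_num) hL
  have hΛper : ∀ j, j ≤ m → ∀ κ : Fin d, IsPeriodic (P / L ^ j) (fun z => (z, κ) ∈ ΛbP m j) := fun j _ κ => by
    rw [hΛb]; exact B9Thm311FlatPositivityZdPer.isPeriodic_mem_torusLamb (P / L ^ j) m j κ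
  have hbox : ∀ j, j ≤ m → ∀ c ∈ ΛbP m j, ∀ x, B7Prop1Local.InBox (B7Prop1Local.loK L j c.1) (B7Prop1Local.bondHiK L j c.1 c.2) x →
      x ∈ i.Ω (j - 1) := fun j _ _ _ x _ => by rw [hΩ]; exact Set.mem_univ x
  obtain ⟨hflatA, hR, havg⟩ := B9Eq316AveragingSquaresZdPer.kernel_conditions_per_of_flat_of_bondPairPer_nonpos τ P hτt hτs hτp hL ΛbP ops₀ M i
    hdvd hΛper hbox hU₀ hU hflat hA.1 h
  -- (a) everywhere
  have ha := plaqCovDeriv_eq_zero_of_lt_of_mem_box P hU hA.1 hflatA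
  -- (c) everywhere at the top level
  haveI := neZero_div'' P hdvd
  have hc : ∀ (y : Site d) (κ : Fin d), linCovIter L U₀ A m y κ = 0 := by
    intro y κ
    have hper : IsPeriodic (P / L ^ m) (fun z => linCovIter L U₀ A m z κ) := fun z n =>
      linCovIter_add_period hU hA.1 (cast_eq_pow_mul_div'' P hdvd) z n κ
    rw [← hper.apply_tlift y]
    exact havg m le_rfl κ _ (tlift_mem_box _) (by rw [hΛb]; exact (B8Thm2TorusMember.mem_torusLamb_iff m m _).2 rfl)
  rw [hΛs] at hR
  exact eq_zero_of_flat_holonomy_kernel τ P hτt hτs hτp hL1 i.hη.ne' hdvd hU₀ hU hflat hA ha hR hc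

/-- ★★★ **POSITIVE DEFINITENESS OF THE GENUINE `Δ_a(U₀)` AT EVERY FLAT PERIODIC BACKGROUND** (same hypotheses): `0 ≠ A ∈ E_𝔤^per(P)` ⟹
`0 < ⟨A, Δ_a(U₀)A⟩_per` — [B9] Theorem 3.11's «Δ_a positive definite» at all flat backgrounds of the torus, trivial AND non-trivial holonomy (the
compact set onto which the class (1.7) shrinks as `α₀ → 0`). [cite: Balaban1985BackgroundPropagators, Thm 3.11 p.416, (3.26)–(3.27) p.395; Balaban1985RegularSpaces, (1.7) p.77, p.77 («Ω_j = T_η»)] -/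
theorem bondPairPer_deltaAOf_opsAllZdPer_pos_of_flat (hτt : ∀ a b : 𝔸, τ (a * b) = τ (b * a))
    (hτs : ∀ a : 𝔸, τ (star a) = starRingEnd ℂ (τ a)) (hτp : ∀ a : 𝔸, a ≠ 0 → 0 < (τ (star a * a)).re)
    (hL : 2 ≤ L) (ops₀ : ℝ → ZdIdx d L → ℕ → OpsZd d 𝔸) (M : ℝ) (i : ZdIdx d L) {m : ℕ}
    (hΛs : i.Λs m = B8Thm4TorusAt.torusLam m) {ΛbP : ℕ → ℕ → Set (Site d × Fin d)} (hΛb : ΛbP m = B8Thm2TorusMember.torusLamb m)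
    (hΩ : ∀ j, i.Ω j = Set.univ) (hdvd : L ^ m ∣ P) {U₀ : Site d → Fin d → 𝔸ˣ} (hU₀ : ∀ x κ, U₀ x κ ∈ unitaryUnits 𝔸) (hU : IsPeriodic P U₀)
    (hflat : ∀ (κ ν : Fin d) (x : Site d), plaqF U₀ κ ν x = 1)
    {A : Site d → Fin d → 𝔸} (hA : A ∈ domSubHPer (d := d) (𝔸 := 𝔸) P) (hA0 : A ≠ 0) :
    0 < bondPairPer τ P A (deltaAOf i.η (opsAllZdPer τ L P ΛbP ops₀ M i m) U₀ A) := by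
  by_contra hle
  exact hA0 (eq_zero_of_flat_of_bondPairPer_deltaAOf_opsAllZdPer_nonpos τ P hτt hτs hτp hL ops₀ M i hΛs hΛb hΩ hdvd hU₀ hU hflat hA (not_lt.1 hle))

/-- ★★ **`RegularAtHPer` AT EVERY FLAT PERIODIC BACKGROUND FOR THE GENUINE TORUS RECORD** (any holonomy): `Δ_a(U₀)` of `opsAllZdPer τ L P ΛbP ops₀` is
invertible on `E_𝔤^per(P)` — the lineage's `regularAtHPer_opsAllZdPer_of_pos` (p641100) fed with the flat positivity above; the `U₀ = 1` case is p645632's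
`regularAtHPer_opsAllZdPer_one`. [cite: Balaban1985BackgroundPropagators, Thm 3.11 p.416, (3.26)–(3.27) p.395; Balaban1985RegularSpaces, (1.58) p.86, p.77 («Ω_j = T_η»)] -/
theorem regularAtHPer_opsAllZdPer_of_flat (hτt : ∀ a b : 𝔸, τ (a * b) = τ (b * a))
    (hτs : ∀ a : 𝔸, τ (star a) = starRingEnd ℂ (τ a)) (hτp : ∀ a : 𝔸, a ≠ 0 → 0 < (τ (star a * a)).re)
    (hL : 2 ≤ L) (ops₀ : ℝ → ZdIdx d L → ℕ → OpsZd d 𝔸) (M : ℝ) (i : ZdIdx d L) {m : ℕ}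
    (hΛs : i.Λs m = B8Thm4TorusAt.torusLam m) {ΛbP : ℕ → ℕ → Set (Site d × Fin d)} (hΛb : ΛbP m = B8Thm2TorusMember.torusLamb m)
    (hΩ : ∀ j, i.Ω j = Set.univ) (hdvd : L ^ m ∣ P) {U₀ : Site d → Fin d → 𝔸ˣ} (hU₀ : ∀ x κ, U₀ x κ ∈ unitaryUnits 𝔸) (hU : IsPeriodic P U₀)
    (hflat : ∀ (κ ν : Fin d) (x : Site d), plaqF U₀ κ ν x = 1) :
    RegularAtHPer i.η (opsLandauPer τ P (withDpZd (withQQP τ L ΛbP ops₀)) M i m) P U₀ :=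
  regularAtHPer_opsAllZdPer_of_pos τ P hL hτp hτt hτs ΛbP ops₀ M i hU₀ hU hdvd
    (fun j _ κ => by rw [hΛb]; exact B9Thm311FlatPositivityZdPer.isPeriodic_mem_torusLamb (P / L ^ j) m j κ)
    (fun j _ _ _ _ x _ => by rw [hΩ]; exact Set.mem_univ x)
    (fun A hA hA0 => bondPairPer_deltaAOf_opsAllZdPer_pos_of_flat τ P hτt hτs hτp hL ops₀ M i hΛs hΛb hΩ hdvd hU₀ hU hflat hA hA0)

/-- ★★ **THE SAME AT lit-balaban's TORUS MEMBER `torusIdx`** (`Ω_j = ℤᵈ`, `Λs = torusLam`, `Λb = torusLamb`; record class `(torusIdx hL1 t).Λb`): at every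
`P`-periodic unitary FLAT background (any holonomy), `Δ_a(U₀)` of the genuine torus record is positive definite on `E_𝔤^per(P)` and `RegularAtHPer` holds,
for every truncation `m` with `Lᵐ ∣ P`. [cite: Balaban1985BackgroundPropagators, Thm 3.11 p.416, (3.26)–(3.27) p.395; Balaban1985RegularSpaces, p.77 («Ω_j = T_η»), Thm 2 p.83] -/
theorem regularAtHPer_opsAllZdPer_of_flat_torusIdx (hτt : ∀ a b : 𝔸, τ (a * b) = τ (b * a))
    (hτs : ∀ a : 𝔸, τ (star a) = starRingEnd ℂ (τ a)) (hτp : ∀ a : 𝔸, a ≠ 0 → 0 < (τ (star a * a)).re)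
    (hL : 2 ≤ L) (hL1 : 1 ≤ L) (t : B8Thm2TorusMember.TorusMember) (ops₀ : ℝ → ZdIdx d L → ℕ → OpsZd d 𝔸) (M : ℝ) {m : ℕ} (hdvd : L ^ m ∣ P)
    {U₀ : Site d → Fin d → 𝔸ˣ} (hU₀ : ∀ x κ, U₀ x κ ∈ unitaryUnits 𝔸) (hU : IsPeriodic P U₀)
    (hflat : ∀ (κ ν : Fin d) (x : Site d), plaqF U₀ κ ν x = 1) :
    (∀ A ∈ domSubHPer (d := d) (𝔸 := 𝔸) P, A ≠ 0 →
      0 < bondPairPer τ P A (deltaAOf (B8Thm2TorusMember.torusIdx (d := d) hL1 t).η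
        (opsAllZdPer τ L P (B8Thm2TorusMember.torusIdx (d := d) hL1 t).Λb ops₀ M (B8Thm2TorusMember.torusIdx hL1 t) m) U₀ A)) ∧
    RegularAtHPer (B8Thm2TorusMember.torusIdx (d := d) hL1 t).η
      (opsLandauPer τ P (withDpZd (withQQP τ L (B8Thm2TorusMember.torusIdx (d := d) hL1 t).Λb ops₀)) M (B8Thm2TorusMember.torusIdx hL1 t) m) P U₀ :=
  ⟨fun _ hA hA0 => bondPairPer_deltaAOf_opsAllZdPer_pos_of_flat τ P hτt hτs hτp hL ops₀ M (B8Thm2TorusMember.torusIdx hL1 t) rfl rfl (fun _ => rfl)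
      hdvd hU₀ hU hflat hA hA0,
    regularAtHPer_opsAllZdPer_of_flat τ P hτt hτs hτp hL ops₀ M (B8Thm2TorusMember.torusIdx hL1 t) rfl rfl (fun _ => rfl) hdvd hU₀ hU hflat⟩

end Record

end Literature.MathematicalPhysics.QuantumFieldTheory.Balaban1983to89.B9Thm311FlatHolonomyKernelZdPer

end
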